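import Summits.ABC.IUTFork.Conditional.WRowFrey37569208117Packages
import HarnessLib

/-!
# R-W WINDOW-TABLE «W:GAP-1019», INHABITED HALF — cells: the hooked slot socket's arithmetic for `7¹¹·19 + 5¹²·1019·7151² = 2²⁸·3¹²·11³·67` at
# `l = 1019` with the pole `7` pinned to the twisted local type `e = 30·1019 = 30570`

PROOF-ONLY file (D-0012; 0 definitions, 0 `Prop` facts; integer arithmetic only) of the abc-iut cell — D-0079 RESCUE sub-cell R-W «WINDOW Θ-SIDE
INEQUALITY», seat abc-iut-w5-d009 (gen 14), row «W:GAP-1019» = the first TYPE-SPLIT row of the R-W table (abc-iut-plan rulings C-R83 (b) / C-R87 (c);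
rw-num-lead «TS» block): half (A) REFUTED at `e(·|7) ∣ 15·l` is this seat's `WRowFrey37569208117GapFifteen` (p494058); half (B) INHABITED at
`e(·|7) = 30·l` is `WRowFrey37569208117GapThirty` over abc-iut-W-row-1's HOOKED slot socket `WRow.licence_triple_slot_of_localType`
(`Cor312LicenceTripleLocalTypeSlot`, hook `Q p e := (p = 7 → e = 30570)`), whose arithmetic hypothesis is THIS file (pattern of abc-iut-W-row-1's
`WRowFrey73NineteenCells`). TAKES NO SIDE on [IUTchIII] Cor. 3.12 or on any author.

THE ARITHMETIC at `l = 1019` (`l⋆ = 509`; desk file work/cells1019.py of this seat = the R-W numerics lead's `margin_U2cell` column): `p = 3` (`v = 12`):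
`e = 10190·n`, tame different, slot `5095·n`, `A = 5`; `p = 5` (`v = 12`): `e = 20380·n`, wild different, slot `5095·n`, `A = 4`; **`p = 7` (`v = 11`):
the hook pins `e = 30570·n` (`n = 1` at the datum), tame, slot `⌊e/6⌋ = 5095·n`, `A = 5`: end cells `−312845` (`j = 1`) and `−2043601` (`j = 509`)**
— versus `+3252225 > 0` at `e = 15285` (half (A)); `p = 11` (`v = 3`, twist): `e = 10190·n`, slot `1019·n`, `A = 1`; `p = 19` (`v = 1`), `7151`
(`v = 2`): `e = 15285·n`, `A = 0`; `p = 67` (`v = 1`, twist): `e = 30570·n`, `A = 0`; `p = 1019 = l` excluded by the socket. Every multiple and every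
label from the two floor-free END cells (`WRow.cell_tameslot_of_ends` / `WRow.cell_wild_of_ends`). HONEST SCOPE: integer arithmetic only; nothing here
bears on the printed inequality; no abc claim. [folklore]
-/

namespace Summit.ABC.IUTFork.Conditional

/-- **The hooked slot socket's `hcell` for `(7¹¹·19, 5¹²·1019·7151², 2²⁸·3¹²·11³·67)` at `l = 1019`, hook `Q p e := (p = 7 → e = 30570)`**: exponents
`A₃ = 5, A₅ = 4, A₇ = 5, A₁₁ = 1, A₁₉ = A₆₇ = A₇₁₅₁ = 0` (`B = A + 1`); every admissible multiple and every label `j ≤ 509` from the two floor-free END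
cells per prime. [folklore] -/
theorem WRow.hcell_frey37569208117_gap1019_localType30 :
    ∀ p : ℕ, p.Prime → p ∣ 7 ^ 11 * 19 * (5 ^ 12 * 1019 * 7151 ^ 2) * (2 ^ 28 * 3 ^ 12 * 11 ^ 3 * 67) → p ≠ 2 → p ≠ 1019 → ∀ e : ℕ, 0 < e → 1019 ∣ e →
      15 * 1019 ∣ e * (7 ^ 11 * 19 * (5 ^ 12 * 1019 * 7151 ^ 2) * (2 ^ 28 * 3 ^ 12 * 11 ^ 3 * 67)).factorization p → (p ∣ 30 → (p - 1) ∣ e) →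
      (p ∣ 2 ^ 28 * 3 ^ 12 * 11 ^ 3 * 67 → Odd ((7 ^ 11 * 19 * (5 ^ 12 * 1019 * 7151 ^ 2) * (2 ^ 28 * 3 ^ 12 * 11 ^ 3 * 67)).factorization p) →
        30 * 1019 ∣ e * (7 ^ 11 * 19 * (5 ^ 12 * 1019 * 7151 ^ 2) * (2 ^ 28 * 3 ^ 12 * 11 ^ 3 * 67)).factorization p) → (p = 7 → e = 30570) →
      (∀ k : ℕ, (e : ℤ) ≠ (p : ℤ) ^ k * ((p : ℤ) - 1)) ∧
      ∀ i : ℕ, i < (1019 - 1) / 2 →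
        (e : ℤ) * ((((i + 1 : ℕ) : ℤ) ^ 2 * ((e * (2 * (7 ^ 11 * 19 * (5 ^ 12 * 1019 * 7151 ^ 2) * (2 ^ 28 * 3 ^ 12 * 11 ^ 3 * 67)).factorization p) / (2 * 1019) : ℕ) : ℤ) -
            ((i + 1 : ℕ) : ℤ) * (((if p ∣ 30 ∧ ¬ p ∣ (7 ^ 11 * 19 * (5 ^ 12 * 1019 * 7151 ^ 2) * (2 ^ 28 * 3 ^ 12 * 11 ^ 3 * 67)).factorization p
              then 2 * e - 1 else e - 1 : ℕ) : ℕ) : ℤ) -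
            ((i + 2 : ℕ) : ℤ) * ((((max 1 (e / (p - 1))) : ℕ) : ℤ))) / (e : ℤ)) +
          ((i + 2 : ℕ) : ℤ) * min ((p : ℤ) ^ (if p = 3 then 5 else if p = 5 then 4 else if p = 7 then 5 else if p = 11 then 1 else 0) -
              ((if p = 3 then 5 else if p = 5 then 4 else if p = 7 then 5 else if p = 11 then 1 else 0 : ℕ) : ℤ) * (e : ℤ))
            ((p : ℤ) ^ (if p = 3 then 6 else if p = 5 then 5 else if p = 7 then 6 else if p = 11 then 2 else 1) -
              ((if p = 3 then 6 else if p = 5 then 5 else if p = 7 then 6 else if p = 11 then 2 else 1 : ℕ) : ℤ) * (e : ℤ)) ≤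
        ((e * (2 * (7 ^ 11 * 19 * (5 ^ 12 * 1019 * 7151 ^ 2) * (2 ^ 28 * 3 ^ 12 * 11 ^ 3 * 67)).factorization p) / (2 * 1019) : ℕ) : ℤ) := by
  intro p hp hpabc h2 hpl e he _hle h15 h30 hodd hq
  rcases WRow.eq_of_prime_dvd_frey37569208117 hp hpabc with rfl | rfl | rfl | rfl | rfl | rfl | rfl | rfl | rfl
  · exact absurd rfl h2
  · -- `p = 3`: `e = 10190·n`, tame different (`3 ∣ v`), slot `5095·n`, `A = 5`
    rw [WRow.factorization_frey37569208117.1] at h15 hodd ⊢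
    norm_num at h15
    rw [show (15285 : ℕ) = 5095 * 3 by norm_num, show e * 12 = e * 4 * 3 by ring] at h15
    have hm : 5095 ∣ e := Nat.Coprime.dvd_of_dvd_mul_right (by norm_num : Nat.Coprime 5095 4) (Nat.dvd_of_mul_dvd_mul_right (by norm_num) h15)
    have hpe : 2 ∣ e := by have := h30 (by norm_num); norm_num at this; exact this
    have he0 : 10190 ∣ e := by
      have := Nat.Coprime.mul_dvd_of_dvd_of_dvd (by norm_num : Nat.Coprime 5095 2) hm hpe
      rwa [show (5095 : ℕ) * 2 = 10190 by norm_num] at this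
    obtain ⟨n, rfl⟩ := he0
    have hn : 1 ≤ n := by omega
    refine ⟨WRow.natCast_ne_pow_mul_sub_one (by norm_num : Nat.Prime 5) (by norm_num) (by norm_num) (by norm_num) ⟨2038 * n, by ring⟩,
      fun i hi => ?_⟩
    rw [if_neg (by norm_num : ¬ ((3 : ℕ) ∣ 30 ∧ ¬ (3 : ℕ) ∣ 12))]
    simp only [ite_true]
    refine WRow.cell_tameslot_of_ends ((3 : ℕ) : ℤ) 10190 (3 - 1) 5095 (2 * 12) (2 * 1019) 5 6 509 1 (by norm_num) (by norm_num) (by norm_num)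
      (by norm_num) (by norm_num) (by norm_num) le_rfl ?_ hi hn
    rintro i (rfl | hi')
    · norm_num
    · obtain rfl : i = 508 := by omega
      norm_num
  · -- `p = 5`: `e = 20380·n`, WILD different, slot `5095·n`, `A = 4`
    rw [WRow.factorization_frey37569208117.2.1] at h15 hodd ⊢
    norm_num at h15
    rw [show (15285 : ℕ) = 5095 * 3 by norm_num, show e * 12 = e * 4 * 3 by ring] at h15
    have hm : 5095 ∣ e := Nat.Coprime.dvd_of_dvd_mul_right (by norm_num : Nat.Coprime 5095 4) (Nat.dvd_of_mul_dvd_mul_right (by norm_num) h15)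
    have hpe : 4 ∣ e := by have := h30 (by norm_num); norm_num at this; exact this
    have he0 : 20380 ∣ e := by
      have := Nat.Coprime.mul_dvd_of_dvd_of_dvd (by norm_num : Nat.Coprime 5095 4) hm hpe
      rwa [show (5095 : ℕ) * 4 = 20380 by norm_num] at this
    obtain ⟨n, rfl⟩ := he0
    have hn : 1 ≤ n := by omega
    refine ⟨WRow.natCast_ne_pow_mul_sub_one (by norm_num : Nat.Prime 1019) (by norm_num) (by norm_num) (by norm_num) ⟨20 * n, by ring⟩,
      fun i hi => ?_⟩
    rw [if_pos ⟨by norm_num, by norm_num⟩, max_eq_right (show 1 ≤ 20380 * n / (5 - 1) by omega)]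
    simp only [show ((5 : ℕ) = 3) = False from eq_false (by decide), ite_true, ite_false]
    refine WRow.cell_wild_of_ends ((5 : ℕ) : ℤ) 20380 (5 - 1) (2 * 12) (2 * 1019) 4 5 509 (by norm_num) (by norm_num) (by norm_num) (by norm_num)
      (by norm_num) (by norm_num) ?_ hi hn
    rintro i (rfl | hi')
    · norm_num
    · obtain rfl : i = 508 := by omega
      norm_num
  · -- `p = 7`: the hook pins `e = 30570` (twisted type `30·l`); tame, slot `5095·n`, `A = 5` — the deciding prime of the TYPE-SPLIT
    rw [WRow.factorization_frey37569208117.2.2.1]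
    obtain ⟨n, rfl⟩ : 30570 ∣ e := ⟨1, by rw [hq rfl]⟩
    have hn : 1 ≤ n := by omega
    refine ⟨WRow.natCast_ne_pow_mul_sub_one (by norm_num : Nat.Prime 5) (by norm_num) (by norm_num) (by norm_num) ⟨6114 * n, by ring⟩,
      fun i hi => ?_⟩
    rw [if_neg (by norm_num : ¬ ((7 : ℕ) ∣ 30 ∧ ¬ (7 : ℕ) ∣ 11))]
    simp only [show ((7 : ℕ) = 3) = False from eq_false (by decide), show ((7 : ℕ) = 5) = False from eq_false (by decide), ite_true, ite_false]
    refine WRow.cell_tameslot_of_ends ((7 : ℕ) : ℤ) 30570 (7 - 1) 5095 (2 * 11) (2 * 1019) 5 6 509 1 (by norm_num) (by norm_num) (by norm_num)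
      (by norm_num) (by norm_num) (by norm_num) le_rfl ?_ hi hn
    rintro i (rfl | hi')
    · norm_num
    · obtain rfl : i = 508 := by omega
      norm_num
  · -- `p = 11`: `v = 3`, `p ∣ c` odd (twist `30l ∣ 3e`): `e = 10190·n`, slot `1019·n`, `A = 1`
    rw [WRow.factorization_frey37569208117.2.2.2.1] at h15 hodd ⊢
    have hT := hodd (by norm_num) (by decide)
    norm_num at hT
    rw [show (30570 : ℕ) = 10190 * 3 by norm_num] at hT
    obtain ⟨n, rfl⟩ := Nat.dvd_of_mul_dvd_mul_right (by norm_num) hT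
    have hn : 1 ≤ n := by omega
    refine ⟨WRow.natCast_ne_pow_mul_sub_one (by norm_num : Nat.Prime 1019) (by norm_num) (by norm_num) (by norm_num) ⟨10 * n, by ring⟩,
      fun i hi => ?_⟩
    rw [if_neg (by norm_num : ¬ ((11 : ℕ) ∣ 30 ∧ ¬ (11 : ℕ) ∣ 3))]
    simp only [show ((11 : ℕ) = 3) = False from eq_false (by decide), show ((11 : ℕ) = 5) = False from eq_false (by decide),
      show ((11 : ℕ) = 7) = False from eq_false (by decide), ite_true, ite_false]
    refine WRow.cell_tameslot_of_ends ((11 : ℕ) : ℤ) 10190 (11 - 1) 1019 (2 * 3) (2 * 1019) 1 2 509 1 (by norm_num) (by norm_num) (by norm_num)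
      (by norm_num) (by norm_num) (by norm_num) le_rfl ?_ hi hn
    rintro i (rfl | hi')
    · norm_num
    · obtain rfl : i = 508 := by omega
      norm_num
  · -- `p = 19`: `v = 1`, `e = 15285·n`, `A = 0`
    rw [WRow.factorization_frey37569208117.2.2.2.2.1] at h15 hodd ⊢
    norm_num at h15
    obtain ⟨n, rfl⟩ := h15
    have hn : 1 ≤ n := by omega
    refine ⟨WRow.natCast_ne_pow_mul_sub_one (by norm_num : Nat.Prime 5) (by norm_num) (by norm_num) (by norm_num) ⟨3057 * n, by ring⟩,
      fun i hi => ?_⟩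
    rw [if_neg (by norm_num : ¬ ((19 : ℕ) ∣ 30 ∧ ¬ (19 : ℕ) ∣ 1))]
    simp only [show ((19 : ℕ) = 3) = False from eq_false (by decide), show ((19 : ℕ) = 5) = False from eq_false (by decide),
      show ((19 : ℕ) = 7) = False from eq_false (by decide), show ((19 : ℕ) = 11) = False from eq_false (by decide), ite_false]
    refine WRow.cell_tameslot_of_ends ((19 : ℕ) : ℤ) 15285 (19 - 1) 0 (2 * 1) (2 * 1019) 0 1 509 1 (by norm_num) (by norm_num) (by norm_num)
      (by norm_num) (by norm_num) (by norm_num) le_rfl ?_ hi hn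
    rintro i (rfl | hi')
    · norm_num
    · obtain rfl : i = 508 := by omega
      norm_num
  · -- `p = 67`: `v = 1`, `p ∣ c` odd (twist): `e = 30570·n`, `A = 0`
    rw [WRow.factorization_frey37569208117.2.2.2.2.2.1] at h15 hodd ⊢
    have hT := hodd (by norm_num) (by decide)
    norm_num at hT
    obtain ⟨n, rfl⟩ := hT
    have hn : 1 ≤ n := by omega
    refine ⟨WRow.natCast_ne_pow_mul_sub_one (by norm_num : Nat.Prime 5) (by norm_num) (by norm_num) (by norm_num) ⟨6114 * n, by ring⟩,
      fun i hi => ?_⟩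
    rw [if_neg (by norm_num : ¬ ((67 : ℕ) ∣ 30 ∧ ¬ (67 : ℕ) ∣ 1))]
    simp only [show ((67 : ℕ) = 3) = False from eq_false (by decide), show ((67 : ℕ) = 5) = False from eq_false (by decide),
      show ((67 : ℕ) = 7) = False from eq_false (by decide), show ((67 : ℕ) = 11) = False from eq_false (by decide), ite_false]
    refine WRow.cell_tameslot_of_ends ((67 : ℕ) : ℤ) 30570 (67 - 1) 0 (2 * 1) (2 * 1019) 0 1 509 1 (by norm_num) (by norm_num) (by norm_num)
      (by norm_num) (by norm_num) (by norm_num) le_rfl ?_ hi hn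
    rintro i (rfl | hi')
    · norm_num
    · obtain rfl : i = 508 := by omega
      norm_num
  · -- `p = 1019 = l`: excluded by the socket
    exact absurd rfl hpl
  · -- `p = 7151`: `v = 2`, `e = 15285·n`, `A = 0`
    rw [WRow.factorization_frey37569208117.2.2.2.2.2.2.2] at h15 hodd ⊢
    norm_num at h15
    obtain ⟨n, rfl⟩ := Nat.Coprime.dvd_of_dvd_mul_right (by norm_num : Nat.Coprime 15285 2) h15
    have hn : 1 ≤ n := by omega
    refine ⟨WRow.natCast_ne_pow_mul_sub_one (by norm_num : Nat.Prime 3) (by norm_num) (by norm_num) (by norm_num) ⟨5095 * n, by ring⟩,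
      fun i hi => ?_⟩
    rw [if_neg (by norm_num : ¬ ((7151 : ℕ) ∣ 30 ∧ ¬ (7151 : ℕ) ∣ 2))]
    simp only [show ((7151 : ℕ) = 3) = False from eq_false (by decide), show ((7151 : ℕ) = 5) = False from eq_false (by decide),
      show ((7151 : ℕ) = 7) = False from eq_false (by decide), show ((7151 : ℕ) = 11) = False from eq_false (by decide), ite_false]
    refine WRow.cell_tameslot_of_ends ((7151 : ℕ) : ℤ) 15285 (7151 - 1) 0 (2 * 2) (2 * 1019) 0 1 509 1 (by norm_num) (by norm_num) (by norm_num)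
      (by norm_num) (by norm_num) (by norm_num) le_rfl ?_ hi hn
    rintro i (rfl | hi')
    · norm_num
    · obtain rfl : i = 508 := by omega
      norm_num

end Summit.ABC.IUTFork.Conditional
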